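import Summits.AnomalousDissipation.AnomalousDissipation.Theorems.SolenoidalFractalHomogenisationLagrangianStepCellChainModes
import Summits.AnomalousDissipation.AnomalousDissipation.Theorems.SolenoidalFractalHomogenisationRealisedQuasiStaticCellLawSlotWindows
import Summits.AnomalousDissipation.AnomalousDissipation.Theorems.SolenoidalFractalHomogenisationLagrangianStepW7ThreeModeDefs
import HarnessLib

/-!
# K1L_D `LagrangianRenormalisationStepDesign` (stmt-AnomalousDissipation-27980), W7 engine sub-piece S1a: INSIDE ONE SLOT the chain of a weak
# solution of the flat tensor cell problem is the GAUGED THREE-TERM CHAIN `dW0C / dWpC / dWmC` (helper; `--supports stmt-AnomalousDissipation-27980`)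

Summits-side helper file of route `SolenoidalFractalHomogenisation` (prover seat `ad-k1l-cellLawV-w1` g4; interface asked by the W7 assembly owner
ad-sawtooth-k1loc-p1 g11 STATUS 21:42:48Z and planner ad-ideate-p4 g13 21:35:38Z (iii): torus units, explicit phases, constant diagonal gauge per slot).
Everything proved; no definitions, no named facts, no sorry.  Setting as in `…CellChainModes` (`h : IsWeakTensorPassiveVectorOn 0 T 𝔹 (W₁.cell n) F u`).

Inside slot `s` (i.e. at times `τ` with `fract(τ/P)·P ∈ [start s, start s + τ_s]`):
* §1 `linkCoeff_eq_zero_of_ne` — every other slot's link vanishes (K2R `trapezoid_eq_zero_of_ne`); `linkCoeff_chain` — the link coefficient is the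
  same on the whole chain `K₀ + ℤK_s` (`ê_s ⊥ m_s`); `modeRHS_slot` — the chain right-hand side has ONE link:
  `modeRHS … k τ = −4π² P_k T_{𝔹ᵀ}(k) û(k) + ℓ(τ) • P_k (e^{−iφ_s} û(k + K_s) − e^{iφ_s} û(k − K_s))`, with the REAL link
  `ℓ(τ) = (ê_s·k)·(1/n)trap_s(τ)/(2|m_s|)` (`linkCoeff_mul_layerAmp`, `linkCoeff_mul_layerAmp'`, `modeRHS_slot_polar`);
* §2 the constant diagonal GAUGE `μ = σ·e^{−iφ_s}`, `σ = ±1`: with `w̃ⱼ := μ^j • û(K₀ + j K_s)` the chain reads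
  `μ^j • modeRHS … (K₀ + jK_s) τ = −4π² P T_{𝔹ᵀ} w̃ⱼ + (σℓ) • P (w̃ⱼ₊₁ − w̃ⱼ₋₁)` (`smul_zpow_modeRHS_chain`) — choosing `σ = sgn(ê_s·K₀)` makes the
  link `σℓ ≥ 0` as the three-mode engine wants;
* §3 **`ae_hasDerivAt_gauged_chain`** — for a.e. `t ∈ (0,T)` in slot `s` and every `j : ℤ`, the gauged representative
  `t ↦ μ^j • modeRep … (K₀ + jK_s) t` has derivative `−modalAdjGen (majorTranspose 𝔹) Kⱼ w̃ⱼ(t) + (σℓ(t)) • P_{Kⱼ}(w̃ⱼ₊₁(t) − w̃ⱼ₋₁(t))`, and the three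
  named shapes `hasDerivAt_gauged_dW0C / _dWpC / _dWmC` (p4 g13's `…W7ThreeModeDefs`: `dW0C l K₀ w̃₊ w̃₋ ỹ₀`, `dWpC l K₊ w̃₀ w̃₊₊ ỹ₊`,
  `dWmC l K₋ w̃₀ w̃₋₋ ỹ₋` with `ỹⱼ = modalAdjGen (majorTranspose 𝔹) Kⱼ w̃ⱼ`).
NOT a proof of any registered stub, of the crux, or of anomalous dissipation; rung F-D1.A0 infrastructure.
-/

set_option linter.dupNamespace false

noncomputable section

namespace Summit.AnomalousDissipation.AnomalousDissipation.Theorems.SolenoidalFractalHomogenisation.LagrangianStep.CellChain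

open Set MeasureTheory Filter Topology Function Complex UnitAddTorus
open scoped InnerProductSpace ComplexConjugate
open Literature.Analysis Literature.Analysis.FunctionSpaces Literature.Analysis.FunctionSpaces.Torus
open Literature.Analysis.FluidPDE Literature.Analysis.FluidPDE.Torus Literature.Analysis.FluidPDE.LatticeShear
open Summit.AnomalousDissipation.AnomalousDissipation.Theorems.SolenoidalFractalHomogenisation.RealisedQuasiStaticCellLaw
open Summit.AnomalousDissipation.AnomalousDissipation.Theorems.SolenoidalFractalHomogenisation.PermissibleCarrier
open Summit.AnomalousDissipation.AnomalousDissipation.Theorems.SolenoidalFractalHomogenisation.LagrangianStep.ThreeMode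

variable {k₀ : ℕ}

/-! ## §1 Inside slot `s`: one link, constant along the chain, in polar form -/

/-- **Inside slot `s` every other link vanishes.** [folklore] -/
theorem linkCoeff_eq_zero_of_ne (W₁ : LatticeWord k₀) (n : ℕ) (k : Fin 3 → ℤ) {s j : Fin k₀} (hjs : j ≠ s) {τ : ℝ}
    (hτ : Int.fract (τ / W₁.period) * W₁.period ∈ Icc (W₁.start s) (W₁.start s + (W₁.phase s).τ)) :
    linkCoeff W₁ n k j τ = 0 := by
  rw [linkCoeff_def, trapezoid_eq_zero_of_ne W₁ hjs hτ, mul_zero, Complex.ofReal_zero, mul_zero]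

/-- The coupling scalar `ê_s·k` is constant along the chain `K₀ + ℤK_s` (`ê_s ⊥ m_s`). [cite: MeshalkinSinai1961, pp. 1700–1705] -/
theorem sum_e_mul_chain (P : LatticePhase) (n : ℕ) (K0 : Fin 3 → ℤ) (j : ℤ) :
    ∑ a, (P.e a : ℂ) * ((K0 + j • fun i => P.m i * (n : ℤ)) a : ℤ) = ∑ a, (P.e a : ℂ) * (K0 a : ℤ) := by
  have h := sum_e_mul_cellFreq P n
  simp only at h
  push_cast at h ⊢
  have hC : ∑ a, (P.e a : ℂ) * ((P.m a : ℂ) * (n : ℂ)) = 0 := by exact_mod_cast h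
  simp only [Pi.add_apply, Pi.smul_apply, smul_eq_mul, Int.cast_add, Int.cast_mul, Int.cast_natCast]
  calc ∑ a, (P.e a : ℂ) * ((K0 a : ℂ) + (j : ℂ) * ((P.m a : ℂ) * (n : ℂ)))
      = ∑ a, (P.e a : ℂ) * (K0 a : ℂ) + (j : ℂ) * ∑ a, (P.e a : ℂ) * ((P.m a : ℂ) * (n : ℂ)) := by
        rw [Finset.mul_sum, ← Finset.sum_add_distrib]
        exact Finset.sum_congr rfl fun a _ => by ring
    _ = ∑ a, (P.e a : ℂ) * (K0 a : ℂ) := by rw [hC, mul_zero, add_zero]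

/-- **The link coefficient is the same on the whole chain**: `linkCoeff (K₀ + jK_s) s = linkCoeff K₀ s`. [cite: MeshalkinSinai1961, pp. 1700–1705] -/
theorem linkCoeff_chain (W₁ : LatticeWord k₀) (n : ℕ) (s : Fin k₀) (K0 : Fin 3 → ℤ) (j : ℤ) (τ : ℝ) :
    linkCoeff W₁ n (K0 + j • fun i => (W₁.phase s).m i * (n : ℤ)) s τ = linkCoeff W₁ n K0 s τ := by
  rw [linkCoeff_def, linkCoeff_def, sum_e_mul_chain]

/-- **One link inside slot `s`.** [cite: MeshalkinSinai1961, pp. 1700–1705] -/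
theorem modeRHS_slot (W₁ : LatticeWord k₀) (n : ℕ) (𝔹 : Torus.Visc4 (Fin 3)) (u : ℝ → UnitAddTorus (Fin 3) → EuclideanSpace ℝ (Fin 3))
    (k : Fin 3 → ℤ) (s : Fin k₀) {τ : ℝ}
    (hτ : Int.fract (τ / W₁.period) * W₁.period ∈ Icc (W₁.start s) (W₁.start s + (W₁.phase s).τ)) :
    modeRHS W₁ n 𝔹 u k τ =
      -(((4 * Real.pi ^ 2 : ℝ) : ℂ) • transversalProj k (Torus.symbT (Torus.majorTranspose 𝔹) k (mFourierCoeff (EuclideanSpace.complexify ∘ u τ) k))) -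
        linkCoeff W₁ n k s τ • transversalProj k
          ((Complex.exp ((W₁.phase s).φ * Complex.I) * (1 / (2 * ((2 * Real.pi * ‖latticeVec (W₁.phase s).m‖ : ℝ) : ℂ) * Complex.I))) •
              mFourierCoeff (EuclideanSpace.complexify ∘ u τ) (k - fun i => (W₁.phase s).m i * n) +
            (starRingEnd ℂ (Complex.exp ((W₁.phase s).φ * Complex.I)) *
                (-(1 / (2 * ((2 * Real.pi * ‖latticeVec (W₁.phase s).m‖ : ℝ) : ℂ) * Complex.I)))) •
              mFourierCoeff (EuclideanSpace.complexify ∘ u τ) (k + fun i => (W₁.phase s).m i * n)) := by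
  rw [modeRHS_def, Finset.sum_eq_single s (fun j _ hjs => by rw [linkCoeff_eq_zero_of_ne W₁ n k hjs hτ, zero_smul])
    (fun hs => absurd (Finset.mem_univ s) hs)]

/-- `conj (e^{iφ}) · e^{iφ} = 1`. [folklore] -/
theorem conj_exp_mul_exp (φ : ℝ) : starRingEnd ℂ (Complex.exp (φ * Complex.I)) * Complex.exp (φ * Complex.I) = 1 := by
  rw [← Complex.exp_conj, ← Complex.exp_add, map_mul, Complex.conj_ofReal, Complex.conj_I]
  have : (φ : ℂ) * -Complex.I + φ * Complex.I = 0 := by ring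
  rw [this, Complex.exp_zero]

/-- `e^{iφ} ≠ 0`, `conj e^{iφ} ≠ 0`. [folklore] -/
theorem conj_exp_ne_zero (φ : ℝ) : starRingEnd ℂ (Complex.exp (φ * Complex.I)) ≠ 0 := by
  rw [map_ne_zero]; exact Complex.exp_ne_zero _

/-- **Polar form of the link × amplitude**: `linkCoeff · a_s = ℓ · e^{iφ_s}`, `ℓ = (ê_s·k)(1/n)trap_s/(2|m_s|)` real. [cite: MeshalkinSinai1961, pp. 1700–1705] -/
theorem linkCoeff_mul_layerAmp (W₁ : LatticeWord k₀) (n : ℕ) (k : Fin 3 → ℤ) (s : Fin k₀) (τ : ℝ) :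
    linkCoeff W₁ n k s τ *
        (Complex.exp ((W₁.phase s).φ * Complex.I) * (1 / (2 * ((2 * Real.pi * ‖latticeVec (W₁.phase s).m‖ : ℝ) : ℂ) * Complex.I))) =
      (((∑ a, (W₁.phase s).e a * (k a : ℝ)) * ((1 / (n : ℝ)) * LatticeWord.trapezoid (W₁.start s) (W₁.phase s).τ W₁.ramp
          (Int.fract (τ / W₁.period) * W₁.period)) / (2 * ‖latticeVec (W₁.phase s).m‖) : ℝ) : ℂ) *
        Complex.exp ((W₁.phase s).φ * Complex.I) := by
  have hm : (‖latticeVec (W₁.phase s).m‖ : ℂ) ≠ 0 := by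
    have := one_le_norm_latticeVec (W₁.phase s).m_ne
    exact_mod_cast (by positivity : ‖latticeVec (W₁.phase s).m‖ ≠ 0)
  have hπ : (Real.pi : ℂ) ≠ 0 := by exact_mod_cast Real.pi_ne_zero
  rw [linkCoeff_def]
  push_cast
  field_simp

/-- **Polar form, second amplitude**: `linkCoeff · a′_s = −ℓ · e^{−iφ_s}`. [cite: MeshalkinSinai1961, pp. 1700–1705] -/
theorem linkCoeff_mul_layerAmp' (W₁ : LatticeWord k₀) (n : ℕ) (k : Fin 3 → ℤ) (s : Fin k₀) (τ : ℝ) :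
    linkCoeff W₁ n k s τ *
        (starRingEnd ℂ (Complex.exp ((W₁.phase s).φ * Complex.I)) *
          (-(1 / (2 * ((2 * Real.pi * ‖latticeVec (W₁.phase s).m‖ : ℝ) : ℂ) * Complex.I)))) =
      -((((∑ a, (W₁.phase s).e a * (k a : ℝ)) * ((1 / (n : ℝ)) * LatticeWord.trapezoid (W₁.start s) (W₁.phase s).τ W₁.ramp
          (Int.fract (τ / W₁.period) * W₁.period)) / (2 * ‖latticeVec (W₁.phase s).m‖) : ℝ) : ℂ) *
        starRingEnd ℂ (Complex.exp ((W₁.phase s).φ * Complex.I))) := by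
  have hm : (‖latticeVec (W₁.phase s).m‖ : ℂ) ≠ 0 := by
    have := one_le_norm_latticeVec (W₁.phase s).m_ne
    exact_mod_cast (by positivity : ‖latticeVec (W₁.phase s).m‖ ≠ 0)
  have hπ : (Real.pi : ℂ) ≠ 0 := by exact_mod_cast Real.pi_ne_zero
  rw [linkCoeff_def]
  push_cast
  field_simp


/-- **The chain right-hand side inside slot `s`, polar form**:
`modeRHS … k τ = −4π² P_k T_{𝔹ᵀ}(k) û(k) + ℓ • P_k (e^{−iφ_s} û(k + K_s) − e^{iφ_s} û(k − K_s))`, `ℓ = (ê_s·k)(1/n)trap_s(τ)/(2|m_s|)` real.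
[cite: MeshalkinSinai1961, pp. 1700–1705] -/
theorem modeRHS_slot_polar (W₁ : LatticeWord k₀) (n : ℕ) (𝔹 : Torus.Visc4 (Fin 3)) (u : ℝ → UnitAddTorus (Fin 3) → EuclideanSpace ℝ (Fin 3))
    (k : Fin 3 → ℤ) (s : Fin k₀) {τ : ℝ}
    (hτ : Int.fract (τ / W₁.period) * W₁.period ∈ Icc (W₁.start s) (W₁.start s + (W₁.phase s).τ)) :
    modeRHS W₁ n 𝔹 u k τ =
      -(((4 * Real.pi ^ 2 : ℝ) : ℂ) • transversalProj k (Torus.symbT (Torus.majorTranspose 𝔹) k (mFourierCoeff (EuclideanSpace.complexify ∘ u τ) k))) +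
        (((∑ a, (W₁.phase s).e a * (k a : ℝ)) * ((1 / (n : ℝ)) * LatticeWord.trapezoid (W₁.start s) (W₁.phase s).τ W₁.ramp
          (Int.fract (τ / W₁.period) * W₁.period)) / (2 * ‖latticeVec (W₁.phase s).m‖) : ℝ) : ℂ) • transversalProj k
          (starRingEnd ℂ (Complex.exp ((W₁.phase s).φ * Complex.I)) • mFourierCoeff (EuclideanSpace.complexify ∘ u τ) (k + fun i => (W₁.phase s).m i * n) -
            Complex.exp ((W₁.phase s).φ * Complex.I) • mFourierCoeff (EuclideanSpace.complexify ∘ u τ) (k - fun i => (W₁.phase s).m i * n)) := by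
  rw [modeRHS_slot W₁ n 𝔹 u k s hτ]
  simp only [map_add, map_sub, map_smul, smul_add, smul_sub, smul_smul, linkCoeff_mul_layerAmp, linkCoeff_mul_layerAmp']
  module

/-! ## §2 The constant diagonal gauge `μ = σ · e^{−iφ_s}` -/

/-- The real coupling scalar `ê_s·k` is constant along the chain. [cite: MeshalkinSinai1961, pp. 1700–1705] -/
theorem sum_e_mul_chain_real (P : LatticePhase) (n : ℕ) (K0 : Fin 3 → ℤ) (j : ℤ) :
    ∑ a, P.e a * (((K0 + j • fun i => P.m i * (n : ℤ)) a : ℤ) : ℝ) = ∑ a, P.e a * (K0 a : ℝ) := by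
  have h := sum_e_mul_chain P n K0 j
  exact_mod_cast h

/-- Gauge algebra, upper neighbour: `σ·ℓ·μ^(j+1) = ℓ·conj(e)·μ^j` for `μ = σ·conj(e)`, `σ = ±1`. [folklore] -/
theorem gauge_mul_zpow_succ {σ : ℝ} (hσ : σ = 1 ∨ σ = -1) (φ : ℝ) (ℓ : ℂ) (j : ℤ) :
    (σ : ℂ) * ℓ * ((σ : ℂ) * starRingEnd ℂ (Complex.exp (φ * Complex.I))) ^ (j + 1) =
      ℓ * starRingEnd ℂ (Complex.exp (φ * Complex.I)) * ((σ : ℂ) * starRingEnd ℂ (Complex.exp (φ * Complex.I))) ^ j := by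
  have hμ : ((σ : ℂ) * starRingEnd ℂ (Complex.exp (φ * Complex.I))) ≠ 0 := by
    refine mul_ne_zero ?_ (conj_exp_ne_zero φ)
    rcases hσ with h | h <;> simp [h]
  rw [zpow_add_one₀ hμ]
  rcases hσ with h | h <;> subst h <;> push_cast <;> ring

/-- Gauge algebra, lower neighbour: `σ·ℓ·μ^(j−1) = ℓ·e·μ^j` for `μ = σ·conj(e)`, `σ = ±1` (`conj(e)·e = 1`). [folklore] -/
theorem gauge_mul_zpow_pred {σ : ℝ} (hσ : σ = 1 ∨ σ = -1) (φ : ℝ) (ℓ : ℂ) (j : ℤ) :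
    (σ : ℂ) * ℓ * ((σ : ℂ) * starRingEnd ℂ (Complex.exp (φ * Complex.I))) ^ (j - 1) =
      ℓ * Complex.exp (φ * Complex.I) * ((σ : ℂ) * starRingEnd ℂ (Complex.exp (φ * Complex.I))) ^ j := by
  have hμ : ((σ : ℂ) * starRingEnd ℂ (Complex.exp (φ * Complex.I))) ≠ 0 := by
    refine mul_ne_zero ?_ (conj_exp_ne_zero φ)
    rcases hσ with h | h <;> simp [h]
  have hce := conj_exp_mul_exp φ
  rw [zpow_sub_one₀ hμ, mul_inv, inv_eq_of_mul_eq_one_right hce]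
  rcases hσ with h | h <;> subst h <;> push_cast <;> norm_num <;> ring

/-- **THE GAUGED CHAIN inside slot `s`** (pointwise identity on the a.e.-defined coefficients): with `K ⱼ = K₀ + j·K_s`, `μ = σ·e^{−iφ_s}`,
`σ = ±1`, `w̃ⱼ = μ^j • û(Kⱼ)` and the real link `ℓ = (ê_s·K₀)(1/n)trap_s(τ)/(2|m_s|)`:
`μ^j • modeRHS … Kⱼ τ = −4π² P_{Kⱼ} T_{𝔹ᵀ}(Kⱼ) w̃ⱼ + (σℓ) • P_{Kⱼ} (w̃ⱼ₊₁ − w̃ⱼ₋₁)`. [cite: MeshalkinSinai1961, pp. 1700–1705] -/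
theorem smul_zpow_modeRHS_chain (W₁ : LatticeWord k₀) (n : ℕ) (𝔹 : Torus.Visc4 (Fin 3))
    (u : ℝ → UnitAddTorus (Fin 3) → EuclideanSpace ℝ (Fin 3)) (s : Fin k₀) (K0 : Fin 3 → ℤ) {σ : ℝ} (hσ : σ = 1 ∨ σ = -1)
    (j : ℤ) {τ : ℝ} (hτ : Int.fract (τ / W₁.period) * W₁.period ∈ Icc (W₁.start s) (W₁.start s + (W₁.phase s).τ)) :
    ((σ : ℂ) * starRingEnd ℂ (Complex.exp ((W₁.phase s).φ * Complex.I))) ^ j • modeRHS W₁ n 𝔹 u (K0 + j • (fun i => (W₁.phase s).m i * (n : ℤ))) τ =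
      -(((4 * Real.pi ^ 2 : ℝ) : ℂ) • transversalProj (K0 + j • (fun i => (W₁.phase s).m i * (n : ℤ)))
          (Torus.symbT (Torus.majorTranspose 𝔹) (K0 + j • (fun i => (W₁.phase s).m i * (n : ℤ)))
            (((σ : ℂ) * starRingEnd ℂ (Complex.exp ((W₁.phase s).φ * Complex.I))) ^ j • mFourierCoeff (EuclideanSpace.complexify ∘ u τ) (K0 + j • (fun i => (W₁.phase s).m i * (n : ℤ)))))) +
        ((σ * ((∑ a, (W₁.phase s).e a * (K0 a : ℝ)) * ((1 / (n : ℝ)) * LatticeWord.trapezoid (W₁.start s) (W₁.phase s).τ W₁.ramp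
          (Int.fract (τ / W₁.period) * W₁.period)) / (2 * ‖latticeVec (W₁.phase s).m‖) : ℝ) : ℝ) : ℂ) • transversalProj (K0 + j • (fun i => (W₁.phase s).m i * (n : ℤ)))
          (((σ : ℂ) * starRingEnd ℂ (Complex.exp ((W₁.phase s).φ * Complex.I))) ^ (j + 1) • mFourierCoeff (EuclideanSpace.complexify ∘ u τ) (K0 + (j + 1) • (fun i => (W₁.phase s).m i * (n : ℤ))) -
            ((σ : ℂ) * starRingEnd ℂ (Complex.exp ((W₁.phase s).φ * Complex.I))) ^ (j - 1) • mFourierCoeff (EuclideanSpace.complexify ∘ u τ) (K0 + (j - 1) • (fun i => (W₁.phase s).m i * (n : ℤ)))) := by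
  set μ : ℂ := (σ : ℂ) * starRingEnd ℂ (Complex.exp ((W₁.phase s).φ * Complex.I)) with hμ_def
  have hKp : K0 + (j + 1) • (fun i => (W₁.phase s).m i * (n : ℤ)) = (K0 + j • (fun i => (W₁.phase s).m i * (n : ℤ))) + fun i => (W₁.phase s).m i * (n : ℤ) := by
    rw [add_zsmul, one_zsmul]; abel
  have hKm : K0 + (j - 1) • (fun i => (W₁.phase s).m i * (n : ℤ)) = (K0 + j • (fun i => (W₁.phase s).m i * (n : ℤ))) - fun i => (W₁.phase s).m i * (n : ℤ) := by
    rw [sub_zsmul, one_zsmul]; abel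
  rw [modeRHS_slot_polar W₁ n 𝔹 u _ s hτ, hKp, hKm, sum_e_mul_chain_real]
  set x := mFourierCoeff (EuclideanSpace.complexify ∘ u τ) ((K0 + j • (fun i => (W₁.phase s).m i * (n : ℤ))) - fun i => (W₁.phase s).m i * (n : ℤ))
  set y := mFourierCoeff (EuclideanSpace.complexify ∘ u τ) ((K0 + j • (fun i => (W₁.phase s).m i * (n : ℤ))) + fun i => (W₁.phase s).m i * (n : ℤ))
  set w := mFourierCoeff (EuclideanSpace.complexify ∘ u τ) (K0 + j • (fun i => (W₁.phase s).m i * (n : ℤ)))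
  set ℓ : ℝ := ((∑ a, (W₁.phase s).e a * (K0 a : ℝ)) * ((1 / (n : ℝ)) * LatticeWord.trapezoid (W₁.start s) (W₁.phase s).τ W₁.ramp
          (Int.fract (τ / W₁.period) * W₁.period)) / (2 * ‖latticeVec (W₁.phase s).m‖) : ℝ) with hℓ_def
  rw [smul_add, smul_neg, smul_comm (μ ^ j) (((4 * Real.pi ^ 2 : ℝ) : ℂ)), ← ContinuousLinearMap.map_smul, ← Torus.symbT_smul]
  congr 1
  -- the link part: move all scalars inside the projection and compare coefficients
  have hA := gauge_mul_zpow_succ hσ (W₁.phase s).φ (ℓ : ℂ) j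
  have hB := gauge_mul_zpow_pred hσ (W₁.phase s).φ (ℓ : ℂ) j
  rw [← hμ_def] at hA hB
  push_cast
  simp only [map_sub, map_smul, smul_sub, smul_smul]
  rw [show μ ^ j * ((ℓ : ℂ) * starRingEnd ℂ (Complex.exp ((W₁.phase s).φ * Complex.I))) = ((σ : ℂ) * (ℓ : ℂ)) * μ ^ (j + 1) by rw [hA]; ring,
    show μ ^ j * ((ℓ : ℂ) * Complex.exp ((W₁.phase s).φ * Complex.I)) = ((σ : ℂ) * (ℓ : ℂ)) * μ ^ (j - 1) by rw [hB]; ring]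


/-! ## §3 The gauged chain as a.e. derivatives of the representatives; the three named shapes -/

/-- **THE GAUGED CHAIN ODE, a.e.**: for a.e. `t ∈ (0,T)`, IF `t` lies in slot `s` (`fract(t/P)·P ∈ [start s, start s + τ_s]`), then for every
`j : ℤ` the gauged representative `x ↦ μ^j • modeRep … (K₀ + jK_s) x` (`μ = σ·e^{−iφ_s}`, `σ = ±1`) has derivative
`−modalAdjGen (majorTranspose 𝔹) Kⱼ w̃ⱼ(t) + (σℓ(t)) • P_{Kⱼ} (w̃ⱼ₊₁(t) − w̃ⱼ₋₁(t))` at `t`, where `w̃ⱼ(t) = μ^j • modeRep … Kⱼ t` and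
`ℓ(t) = (ê_s·K₀)(1/n)trap_s(t)/(2|m_s|)` (all modes read on their continuous representatives).
[cite: MeshalkinSinai1961, pp. 1700–1705] [cite: Temam1984, Ch. III §1.1] -/
theorem ae_hasDerivAt_gauged_chain (W₁ : LatticeWord k₀) (n : ℕ) {T : ℝ} (hT : 0 ≤ T) {𝔹 : Torus.Visc4 (Fin 3)}
    {F : UnitAddTorus (Fin 3) → EuclideanSpace ℝ (Fin 3)} {u : ℝ → UnitAddTorus (Fin 3) → EuclideanSpace ℝ (Fin 3)}
    (h : Torus.IsWeakTensorPassiveVectorOn 0 T 𝔹 (W₁.cell n) F u) (hF : Integrable F volume) (s : Fin k₀) (K0 : Fin 3 → ℤ)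
    {σ : ℝ} (hσ : σ = 1 ∨ σ = -1) :
    ∀ᵐ t ∂(volume.restrict (Ioo 0 T)),
      Int.fract (t / W₁.period) * W₁.period ∈ Icc (W₁.start s) (W₁.start s + (W₁.phase s).τ) →
      ∀ j : ℤ, HasDerivAt (fun x => ((σ : ℂ) * starRingEnd ℂ (Complex.exp ((W₁.phase s).φ * Complex.I))) ^ j • modeRep W₁ n 𝔹 F u (K0 + j • (fun i => (W₁.phase s).m i * (n : ℤ))) x)
        (-(Torus.modalAdjGen (Torus.majorTranspose 𝔹) (K0 + j • (fun i => (W₁.phase s).m i * (n : ℤ))) (((σ : ℂ) * starRingEnd ℂ (Complex.exp ((W₁.phase s).φ * Complex.I))) ^ j • modeRep W₁ n 𝔹 F u (K0 + j • (fun i => (W₁.phase s).m i * (n : ℤ))) t)) +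
          ((σ * ((∑ a, (W₁.phase s).e a * (K0 a : ℝ)) * ((1 / (n : ℝ)) * LatticeWord.trapezoid (W₁.start s) (W₁.phase s).τ W₁.ramp
          (Int.fract (t / W₁.period) * W₁.period)) / (2 * ‖latticeVec (W₁.phase s).m‖) : ℝ) : ℝ) : ℂ) • transversalProj (K0 + j • (fun i => (W₁.phase s).m i * (n : ℤ)))
            (((σ : ℂ) * starRingEnd ℂ (Complex.exp ((W₁.phase s).φ * Complex.I))) ^ (j + 1) • modeRep W₁ n 𝔹 F u (K0 + (j + 1) • (fun i => (W₁.phase s).m i * (n : ℤ))) t -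
              ((σ : ℂ) * starRingEnd ℂ (Complex.exp ((W₁.phase s).φ * Complex.I))) ^ (j - 1) • modeRep W₁ n 𝔹 F u (K0 + (j - 1) • (fun i => (W₁.phase s).m i * (n : ℤ))) t)) t := by
  have hd : ∀ᵐ t ∂(volume.restrict (Ioo 0 T)), ∀ k, HasDerivAt (modeRep W₁ n 𝔹 F u k) (modeRHS W₁ n 𝔹 u k t) t :=
    ae_all_iff.2 fun k => ae_restrict_hasDerivAt_modeRep W₁ n hT h k
  filter_upwards [hd, ae_forall_eq_modeRep W₁ n hT h hF] with t hdt hrep hslot j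
  have h1 := (hdt (K0 + j • (fun i => (W₁.phase s).m i * (n : ℤ)))).const_smul (((σ : ℂ) * starRingEnd ℂ (Complex.exp ((W₁.phase s).φ * Complex.I))) ^ j)
  rw [smul_zpow_modeRHS_chain W₁ n 𝔹 u s K0 hσ j hslot, hrep, hrep, hrep] at h1
  rw [Torus.modalAdjGen_apply]
  exact h1

/-- `dWpC` rearranged: `dWpC l K w₀ w₊₊ y₊ = −y₊ + l • P_K (w₊₊ − w₀)`. [cite: BedrossianCotiZelati2017, §2 (hypocoercivity functional with a cross term)] -/
theorem dWpC_eq_neg_add (l : ℝ) (K : Fin 3 → ℤ) (w0 wpp yp : EuclideanSpace ℂ (Fin 3)) :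
    dWpC l K w0 wpp yp = -yp + (l : ℂ) • transversalProj K (wpp - w0) := by
  rw [dWpC, map_sub, smul_sub, smul_sub]
  abel

/-- `dWmC` rearranged: `dWmC l K w₀ w₋₋ y₋ = −y₋ + l • P_K (w₀ − w₋₋)`. [cite: BedrossianCotiZelati2017, §2 (hypocoercivity functional with a cross term)] -/
theorem dWmC_eq_neg_add (l : ℝ) (K : Fin 3 → ℤ) (w0 wmm ym : EuclideanSpace ℂ (Fin 3)) :
    dWmC l K w0 wmm ym = -ym + (l : ℂ) • transversalProj K (w0 - wmm) := by
  rw [dWmC, map_sub, smul_sub, smul_sub]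
  abel

/-- **Mode `0` of the gauged chain has the shape `dW0C`** (p4 g13's `…W7ThreeModeDefs`): with `Kⱼ = K₀ + jK_s`, `w̃ⱼ = μ^j • modeRep … Kⱼ`,
`ỹ₀ = modalAdjGen (majorTranspose 𝔹) K₀ w̃₀`, `l = σℓ`: `HasDerivAt w̃₀ (dW0C l K₀ w̃₁ w̃₋₁ ỹ₀) t` for a.e. `t` in slot `s`.
[cite: BedrossianCotiZelati2017, §2 (hypocoercivity functional with a cross term)] -/
theorem ae_hasDerivAt_gauged_dW0C (W₁ : LatticeWord k₀) (n : ℕ) {T : ℝ} (hT : 0 ≤ T) {𝔹 : Torus.Visc4 (Fin 3)}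
    {F : UnitAddTorus (Fin 3) → EuclideanSpace ℝ (Fin 3)} {u : ℝ → UnitAddTorus (Fin 3) → EuclideanSpace ℝ (Fin 3)}
    (h : Torus.IsWeakTensorPassiveVectorOn 0 T 𝔹 (W₁.cell n) F u) (hF : Integrable F volume) (s : Fin k₀) (K0 : Fin 3 → ℤ)
    {σ : ℝ} (hσ : σ = 1 ∨ σ = -1) :
    ∀ᵐ t ∂(volume.restrict (Ioo 0 T)),
      Int.fract (t / W₁.period) * W₁.period ∈ Icc (W₁.start s) (W₁.start s + (W₁.phase s).τ) →
      HasDerivAt (fun x => ((σ : ℂ) * starRingEnd ℂ (Complex.exp ((W₁.phase s).φ * Complex.I))) ^ (0:ℤ) • modeRep W₁ n 𝔹 F u (K0 + (0:ℤ) • (fun i => (W₁.phase s).m i * (n : ℤ))) x)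
        (dW0C (σ * ((∑ a, (W₁.phase s).e a * (K0 a : ℝ)) * ((1 / (n : ℝ)) * LatticeWord.trapezoid (W₁.start s) (W₁.phase s).τ W₁.ramp
          (Int.fract (t / W₁.period) * W₁.period)) / (2 * ‖latticeVec (W₁.phase s).m‖) : ℝ)) (K0 + (0:ℤ) • (fun i => (W₁.phase s).m i * (n : ℤ)))
          (((σ : ℂ) * starRingEnd ℂ (Complex.exp ((W₁.phase s).φ * Complex.I))) ^ (1:ℤ) • modeRep W₁ n 𝔹 F u (K0 + (1:ℤ) • (fun i => (W₁.phase s).m i * (n : ℤ))) t)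
          (((σ : ℂ) * starRingEnd ℂ (Complex.exp ((W₁.phase s).φ * Complex.I))) ^ (-1:ℤ) • modeRep W₁ n 𝔹 F u (K0 + (-1:ℤ) • (fun i => (W₁.phase s).m i * (n : ℤ))) t)
          (Torus.modalAdjGen (Torus.majorTranspose 𝔹) (K0 + (0:ℤ) • (fun i => (W₁.phase s).m i * (n : ℤ))) (((σ : ℂ) * starRingEnd ℂ (Complex.exp ((W₁.phase s).φ * Complex.I))) ^ (0:ℤ) • modeRep W₁ n 𝔹 F u (K0 + (0:ℤ) • (fun i => (W₁.phase s).m i * (n : ℤ))) t))) t := by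
  filter_upwards [ae_hasDerivAt_gauged_chain W₁ n hT h hF s K0 hσ] with t ht hslot
  have h0 := ht hslot 0
  rw [dW0C]
  convert h0 using 2
  all_goals norm_num

/-- **Mode `+1` has the shape `dWpC`**: `HasDerivAt w̃₁ (dWpC l K₁ w̃₀ w̃₂ ỹ₁) t` for a.e. `t` in slot `s`.
[cite: BedrossianCotiZelati2017, §2 (hypocoercivity functional with a cross term)] -/
theorem ae_hasDerivAt_gauged_dWpC (W₁ : LatticeWord k₀) (n : ℕ) {T : ℝ} (hT : 0 ≤ T) {𝔹 : Torus.Visc4 (Fin 3)}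
    {F : UnitAddTorus (Fin 3) → EuclideanSpace ℝ (Fin 3)} {u : ℝ → UnitAddTorus (Fin 3) → EuclideanSpace ℝ (Fin 3)}
    (h : Torus.IsWeakTensorPassiveVectorOn 0 T 𝔹 (W₁.cell n) F u) (hF : Integrable F volume) (s : Fin k₀) (K0 : Fin 3 → ℤ)
    {σ : ℝ} (hσ : σ = 1 ∨ σ = -1) :
    ∀ᵐ t ∂(volume.restrict (Ioo 0 T)),
      Int.fract (t / W₁.period) * W₁.period ∈ Icc (W₁.start s) (W₁.start s + (W₁.phase s).τ) →
      HasDerivAt (fun x => ((σ : ℂ) * starRingEnd ℂ (Complex.exp ((W₁.phase s).φ * Complex.I))) ^ (1:ℤ) • modeRep W₁ n 𝔹 F u (K0 + (1:ℤ) • (fun i => (W₁.phase s).m i * (n : ℤ))) x)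
        (dWpC (σ * ((∑ a, (W₁.phase s).e a * (K0 a : ℝ)) * ((1 / (n : ℝ)) * LatticeWord.trapezoid (W₁.start s) (W₁.phase s).τ W₁.ramp
          (Int.fract (t / W₁.period) * W₁.period)) / (2 * ‖latticeVec (W₁.phase s).m‖) : ℝ)) (K0 + (1:ℤ) • (fun i => (W₁.phase s).m i * (n : ℤ)))
          (((σ : ℂ) * starRingEnd ℂ (Complex.exp ((W₁.phase s).φ * Complex.I))) ^ (0:ℤ) • modeRep W₁ n 𝔹 F u (K0 + (0:ℤ) • (fun i => (W₁.phase s).m i * (n : ℤ))) t)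
          (((σ : ℂ) * starRingEnd ℂ (Complex.exp ((W₁.phase s).φ * Complex.I))) ^ (2:ℤ) • modeRep W₁ n 𝔹 F u (K0 + (2:ℤ) • (fun i => (W₁.phase s).m i * (n : ℤ))) t)
          (Torus.modalAdjGen (Torus.majorTranspose 𝔹) (K0 + (1:ℤ) • (fun i => (W₁.phase s).m i * (n : ℤ))) (((σ : ℂ) * starRingEnd ℂ (Complex.exp ((W₁.phase s).φ * Complex.I))) ^ (1:ℤ) • modeRep W₁ n 𝔹 F u (K0 + (1:ℤ) • (fun i => (W₁.phase s).m i * (n : ℤ))) t))) t := by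
  filter_upwards [ae_hasDerivAt_gauged_chain W₁ n hT h hF s K0 hσ] with t ht hslot
  have h0 := ht hslot 1
  rw [dWpC_eq_neg_add]
  convert h0 using 2
  all_goals norm_num

/-- **Mode `−1` has the shape `dWmC`**: `HasDerivAt w̃₋₁ (dWmC l K₋₁ w̃₀ w̃₋₂ ỹ₋₁) t` for a.e. `t` in slot `s`.
[cite: BedrossianCotiZelati2017, §2 (hypocoercivity functional with a cross term)] -/
theorem ae_hasDerivAt_gauged_dWmC (W₁ : LatticeWord k₀) (n : ℕ) {T : ℝ} (hT : 0 ≤ T) {𝔹 : Torus.Visc4 (Fin 3)}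
    {F : UnitAddTorus (Fin 3) → EuclideanSpace ℝ (Fin 3)} {u : ℝ → UnitAddTorus (Fin 3) → EuclideanSpace ℝ (Fin 3)}
    (h : Torus.IsWeakTensorPassiveVectorOn 0 T 𝔹 (W₁.cell n) F u) (hF : Integrable F volume) (s : Fin k₀) (K0 : Fin 3 → ℤ)
    {σ : ℝ} (hσ : σ = 1 ∨ σ = -1) :
    ∀ᵐ t ∂(volume.restrict (Ioo 0 T)),
      Int.fract (t / W₁.period) * W₁.period ∈ Icc (W₁.start s) (W₁.start s + (W₁.phase s).τ) →
      HasDerivAt (fun x => ((σ : ℂ) * starRingEnd ℂ (Complex.exp ((W₁.phase s).φ * Complex.I))) ^ (-1:ℤ) • modeRep W₁ n 𝔹 F u (K0 + (-1:ℤ) • (fun i => (W₁.phase s).m i * (n : ℤ))) x)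
        (dWmC (σ * ((∑ a, (W₁.phase s).e a * (K0 a : ℝ)) * ((1 / (n : ℝ)) * LatticeWord.trapezoid (W₁.start s) (W₁.phase s).τ W₁.ramp
          (Int.fract (t / W₁.period) * W₁.period)) / (2 * ‖latticeVec (W₁.phase s).m‖) : ℝ)) (K0 + (-1:ℤ) • (fun i => (W₁.phase s).m i * (n : ℤ)))
          (((σ : ℂ) * starRingEnd ℂ (Complex.exp ((W₁.phase s).φ * Complex.I))) ^ (0:ℤ) • modeRep W₁ n 𝔹 F u (K0 + (0:ℤ) • (fun i => (W₁.phase s).m i * (n : ℤ))) t)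
          (((σ : ℂ) * starRingEnd ℂ (Complex.exp ((W₁.phase s).φ * Complex.I))) ^ (-2:ℤ) • modeRep W₁ n 𝔹 F u (K0 + (-2:ℤ) • (fun i => (W₁.phase s).m i * (n : ℤ))) t)
          (Torus.modalAdjGen (Torus.majorTranspose 𝔹) (K0 + (-1:ℤ) • (fun i => (W₁.phase s).m i * (n : ℤ))) (((σ : ℂ) * starRingEnd ℂ (Complex.exp ((W₁.phase s).φ * Complex.I))) ^ (-1:ℤ) • modeRep W₁ n 𝔹 F u (K0 + (-1:ℤ) • (fun i => (W₁.phase s).m i * (n : ℤ))) t))) t := by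
  filter_upwards [ae_hasDerivAt_gauged_chain W₁ n hT h hF s K0 hσ] with t ht hslot
  have h0 := ht hslot (-1)
  rw [dWmC_eq_neg_add]
  convert h0 using 2
  all_goals norm_num

end Summit.AnomalousDissipation.AnomalousDissipation.Theorems.SolenoidalFractalHomogenisation.LagrangianStep.CellChain

end
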